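import Mathlib.MeasureTheory.Measure.Prokhorov
import Mathlib.MeasureTheory.Integral.Bochner.Basic
import Mathlib.Topology.ContinuousMap.Bounded.Basic

/-!
# `MomentParity.MomentClosure` (stmt-AnomalousDissipation-11467), helper II: weak-* limits of
# probability measures carried by a fixed compact set

Support file for the proof of
`Summit.AnomalousDissipation.AnomalousDissipation.Theses.MomentParity.MomentClosure`.
The compactness step of the item, in abstract form and WITHOUT subsequences or metrisability:

* `mem_of_mapClusterPt` — a continuous real function of a cluster point of a sequence takes its
  value in every closed set that eventually contains the values along the sequence;
* `exists_limit_measure_of_isCompact` — **the limit measure**: if Borel probability measures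
  `μ d` (`d : ℕ`) on a Hausdorff space are all carried by one compact set `K`, there is a Borel
  probability measure `μ'` carried by `K` such that `∫ F dμ' ∈ C` for every continuous real `F` and
  every closed `C ⊆ ℝ` with `∫ F d(μ d) ∈ C` eventually. Proof: pull the `μ d` back to the compact
  space `K` (`Measure.comap Subtype.val`), where Mathlib's Riesz–Markov–Kakutani/Prokhorov instance
  `CompactSpace (ProbabilityMeasure K)` provides a cluster point, and push it forward again; the
  weak topology makes `Q ↦ ∫ g dQ` continuous for `g ∈ C(K, ℝ)`
  (`ProbabilityMeasure.continuous_integral_continuousMap`);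
* `integrable_of_continuous_of_ae_mem`, `lintegral_eq_ofReal_integral` — bookkeeping for measures
  carried by a compact set (continuous functions are integrable; `∫⁻` of an a.e. `ofReal`-valued
  integrand is `ofReal ∫`).
-/

noncomputable section

-- `Summit.<Summit>.<Problem>` is the tree's mandated summit-side namespace (CONVENTIONS §2); for this
-- single-conjunct summit the two coincide, so the duplicate is deliberate.
set_option linter.dupNamespace false

namespace Summit.AnomalousDissipation.AnomalousDissipation.Theorems.MomentParityMomentClosure

open MeasureTheory Filter Topology Set
open scoped ENNReal NNReal

/-- **Cluster values respect closed eventual constraints**: if `x` is a cluster point of the sequence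
`P` and `f` is continuous with `f (P d) ∈ C` eventually, `C` closed, then `f x ∈ C`. [folklore] -/
theorem mem_of_mapClusterPt {X : Type*} [TopologicalSpace X] {x : X} {P : ℕ → X}
    (h : MapClusterPt x atTop P) {f : X → ℝ} (hf : Continuous f) {C : Set ℝ} (hC : IsClosed C)
    (hP : ∀ᶠ d in atTop, f (P d) ∈ C) : f x ∈ C := by
  have h' : MapClusterPt (f x) atTop (f ∘ P) := h.continuousAt_comp hf.continuousAt
  rw [← hC.closure_eq, mem_closure_iff_nhds]
  intro s hs
  obtain ⟨d, hd1, hd2⟩ := ((mapClusterPt_iff_frequently.1 h' s hs).and_eventually hP).exists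
  exact ⟨f (P d), hd1, hd2⟩

/-- **Weak-* limit of probability measures carried by a fixed compact set** (the compactness step
of FMRT 2001, Ch. IV App. B for stationary statistical solutions, in finite dimensions): Borel
probability measures `μ d` on a Hausdorff space, all carried by one compact `K`, admit a Borel
probability measure `μ'` carried by `K` with `∫ F dμ' ∈ C` whenever `F` is continuous, `C ⊆ ℝ` is
closed and `∫ F d(μ d) ∈ C` for all large `d`. No metrisability or subsequence is used: `μ'` is the
push-forward of a cluster point of the pulled-back sequence in the compact space
`ProbabilityMeasure K`. [folklore] -/
theorem exists_limit_measure_of_isCompact {X : Type*} [TopologicalSpace X] [T2Space X]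
    [MeasurableSpace X] [BorelSpace X] {K : Set X} (hK : IsCompact K) (μ : ℕ → Measure X)
    (hμ : ∀ d, IsProbabilityMeasure (μ d)) (hμK : ∀ d, ∀ᵐ x ∂μ d, x ∈ K) :
    ∃ μ' : Measure X, IsProbabilityMeasure μ' ∧ (∀ᵐ x ∂μ', x ∈ K) ∧
      ∀ (F : X → ℝ), Continuous F → ∀ (C : Set ℝ), IsClosed C →
        (∀ᶠ d in atTop, (∫ x, F x ∂μ d) ∈ C) → (∫ x, F x ∂μ') ∈ C := by
  have hKm : MeasurableSet K := hK.isClosed.measurableSet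
  have hemb : MeasurableEmbedding ((↑) : K → X) := MeasurableEmbedding.subtype_coe hKm
  haveI : CompactSpace K := isCompact_iff_compactSpace.1 hK
  -- the measures are their own restrictions to `K`, hence push-forwards of their pull-backs
  have hmc : ∀ d, (Measure.comap ((↑) : K → X) (μ d)).map ((↑) : K → X) = μ d := fun d => by
    rw [map_comap_subtype_coe hKm, Measure.restrict_eq_self_of_ae_mem (hμK d)]
  have hprob : ∀ d, IsProbabilityMeasure (Measure.comap ((↑) : K → X) (μ d)) := fun d => by
    haveI := hμ d
    refine ⟨?_⟩
    rw [hemb.comap_apply, image_univ, Subtype.range_coe]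
    exact (prob_compl_eq_zero_iff hKm).1 (mem_ae_iff.1 (hμK d))
  set P : ℕ → ProbabilityMeasure K := fun d => ⟨Measure.comap ((↑) : K → X) (μ d), hprob d⟩
    with hP_def
  -- a cluster point in the compact space of probability measures on `K`
  obtain ⟨P', -, hP'⟩ := isCompact_univ.exists_mapClusterPt (f := atTop) (u := P)
    (le_principal_iff.2 univ_mem)
  refine ⟨(P' : Measure K).map ((↑) : K → X),
    Measure.isProbabilityMeasure_map measurable_subtype_coe.aemeasurable,
    hemb.ae_map_iff.2 (Eventually.of_forall fun z => z.2), fun F hF C hC hFC => ?_⟩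
  set g : C(K, ℝ) := ⟨fun z => F z, hF.comp continuous_subtype_val⟩ with hg_def
  have hg : Continuous fun Q : ProbabilityMeasure K => ∫ z, g z ∂(Q : Measure K) :=
    ProbabilityMeasure.continuous_integral_continuousMap g
  have h1 : ∀ d, ∫ x, F x ∂μ d = ∫ z, g z ∂(P d : Measure K) := fun d => by
    rw [← hmc d, hemb.integral_map]
    rfl
  have h2 : ∫ x, F x ∂(P' : Measure K).map ((↑) : K → X) = ∫ z, g z ∂(P' : Measure K) := by
    rw [hemb.integral_map]
    rfl
  rw [h2]
  refine mem_of_mapClusterPt hP' hg hC ?_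
  filter_upwards [hFC] with d hd
  rwa [h1 d] at hd

/-- A continuous real function is integrable for a finite measure carried by a compact set. [folklore] -/
theorem integrable_of_continuous_of_ae_mem {X : Type*} [TopologicalSpace X] [MeasurableSpace X]
    [OpensMeasurableSpace X] {K : Set X} (hK : IsCompact K) {μ : Measure X} [IsFiniteMeasure μ]
    (hμK : ∀ᵐ x ∂μ, x ∈ K) {F : X → ℝ} (hF : Continuous F) : Integrable F μ := by
  obtain ⟨M, hM⟩ := hK.exists_bound_of_continuousOn hF.continuousOn
  exact (integrable_const M).mono' hF.aestronglyMeasurable (hμK.mono fun x hx => hM x hx)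
/-- `∫⁻` of an integrand that is a.e. `ofReal` of a nonnegative integrable real function `e` is
`ofReal (∫ e)`. [folklore] -/
theorem lintegral_eq_ofReal_integral {X : Type*} [MeasurableSpace X] {μ : Measure X}
    {G : X → ℝ≥0∞} {e : X → ℝ} (he : Integrable e μ) (he0 : ∀ x, 0 ≤ e x)
    (hG : ∀ᵐ x ∂μ, G x = ENNReal.ofReal (e x)) :
    ∫⁻ x, G x ∂μ = ENNReal.ofReal (∫ x, e x ∂μ) := by
  rw [lintegral_congr_ae hG, ← ofReal_integral_eq_lintegral_ofReal he (ae_of_all _ he0)]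

/-- **The integral of a small integrand is small**: on a probability space, `‖∫ F‖ ≤ δ` if
`‖F‖ ≤ δ` almost everywhere. [folklore] -/
theorem norm_integral_le_of_ae_norm_le {X : Type*} [MeasurableSpace X] {μ : Measure X}
    [IsProbabilityMeasure μ] {F : X → ℝ} {δ : ℝ} (h : ∀ᵐ x ∂μ, ‖F x‖ ≤ δ) :
    ‖∫ x, F x ∂μ‖ ≤ δ := by
  have h1 := norm_integral_le_of_norm_le_const h
  rwa [probReal_univ, mul_one] at h1

end Summit.AnomalousDissipation.AnomalousDissipation.Theorems.MomentParityMomentClosure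

end
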